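import Summits.Ventures.CertifiedManyBodySolver.Downfold.BoxesLa214V115M2cPhaseSeparation
import Literature.MathematicalPhysics.QuantumLattice.HubbardFermiSeaTangentRowsDiluteLa214
import HarnessLib

/-!
# Ventures/CertifiedManyBodySolver — Downfold/BoxesLa214V115M2cPhaseSeparationDilute.lean

HONEST FRAMING: as the parent `Downfold/BoxesLa214V115M2cPhaseSeparation.lean` — «competing orders» words of CONTROL class on
cells of the La₂₋ₓSrₓCuO₄ `x = 1/8` one-band box (`t′/t ∈ [−3/10, −1/5]`, filling `7/8`): EXCLUSION of macroscopic phase separation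
of a translation-invariant ground state into the half-filled (or denser) phase and a DILUTE phase of density `≤ n₁`; conditional BY
NAME on the same claim nodes (VARBOX plane `cert_obx32x4tpm1o4D1200_openbox_32x4_N112_planes`; K2DIAG-A bootstraps
`cert_laBoxE_K2diag_GU29o5n1tpm3o10_j295889_up`, `cert_laBoxE_K2diag_GU8n1tpm3o10_j299783_up`; registry #21 · #487 · #427 · #488 ·
#472 · #428); nothing about stripes, about separation into a phase of hole doping `≲ 0.7`, about `T > 0` or superconductivity;
nothing about La₁.₈₇₅Sr₀.₁₂₅CuO₄; no number of record. Zero compute beyond the parent rows' kernel `decide`s.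

Cell `pub/hubbard-downfold` (MO-S1 ↔ S2 seam; D-0096 (iii)), seat `hubbard-downfold-unc-2` (`prover-hubbard-downfold-unc-2-g19-0`).
WHAT IS NEW: the dilute floors now come from the kernel Fermi-sea tangent rows TOUCHING AT `n₀ ∈ {1/4, 3/10}`
(`HubbardFermiSeaTangentRowsDiluteLa214`, this seat, hubbard-box-eng-1's generator unchanged) instead of the `n₀ = 1/2` tangents read
far from their touch density (loss `0.04–0.13·t` there); cap and `n = 1` column laws are the parent's (§1–§2 there). RESULT
(exact column margins in parentheses, smallest end value, units of `t`):
* §2 `lsco78_not_groundState_mix_le_1o5_ge_one_v2` — `(≤ 1/5 | ≥ 1)` EXCLUDED on `t′ ∈ [−3/10, −1/5] × U ∈ [36/5, 9]`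
  (`0.0021` at `36/5`, `0.0228`/`0.0307` at `8`, `0.0048` at `9`; parent: `U ∈ [38/5, 43/5]`);
* §3 `lsco78_not_groundState_mix_le_1o4_ge_one_v2` — `(≤ 1/4 | ≥ 1)` EXCLUDED on `t′ ∈ [−3/10, −1/5] × U ∈ [38/5, 43/5]`
  (`0.0045` at `38/5`, `0.0020` at `43/5`; parent: `U ∈ [31/4, 33/4]`);
* §4 `lsco78_not_groundState_mix_le_3o10_ge_one_right` — `(≤ 3/10 | ≥ 1)` EXCLUDED on `t′ ∈ [−1/4, −1/5] × U ∈ [31/4, 83/10]`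
  (`0.0008` at both ends) and `…_le_3o10_ge_one` on `t′ ∈ [−3/10, −1/5] × U ∈ [8, 81/10]` (`0.0009`–`0.0011`): the `x = 1/8` ground state of
  the box model is not a macroscopic mixture of the half-filled phase and a phase of hole doping `≥ 70 %` there.
CENSUS (unchanged diagnosis): the binding slack is the `n = 1` floor at `t′ ≠ 0` (K₂-bootstrap, `≈ 0.1` [est] below) and the VARBOX cap
(`≈ 0.08` [est] above); the dilute floor is now within `10⁻³` of exact at its touch density. `(≤ 1/2 | ≥ 1)` on this cell needs both
windows at `(8, ·, −1/4)` within `≈ 0.03`.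
References: V. J. Emery, S. A. Kivelson, H. Q. Lin, PRL 64 (1990) 475 [EmeryKivelsonLin1990]; R. B. Israel, *Convexity in the Theory
of Lattice Gases* (1979) Thm I.2.4 [Israel1979]; E. H. Lieb, M. Loss, Duke Math. J. 71 (1993) 337, §8 [LiebLoss1993].
-/

noncomputable section

namespace Summit.Ventures.CertifiedManyBodySolver.Downfold

open Summit.Ventures.CertifiedManyBodySolver.Observables
open Summit.Ventures.CertifiedManyBodySolver.Certificates
open Literature.MathematicalPhysics.QuantumLattice Literature.MathematicalPhysics.QuantumLattice.ThermodynamicLimit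
open Literature.MathematicalPhysics.QuantumLattice.InfVolFermionState Set

/-! ## §1 Dilute floors from the rows touching at `1/4` and at `3/10` (`t′`-chords, every `U ≥ 0`) -/

/-- **Dilute floor on `t′ ∈ [-3/10, -1/4]` from the rows touching at `1/4`** (any density `0 ≤ n₁ < 2`, every `U ≥ 0`; the
`t′`-chord of the two end rows). [cite: LiebLoss1993, §8, Theorem 8.2] [cite: Ruelle1969, §3.3] -/
theorem lsco_dilute14_floor_left {n₁ : ℝ} (hn0 : 0 ≤ n₁) (hn2 : n₁ < 2) :
    ∀ s ∈ Icc (-3 / 10 : ℝ) (-1 / 4), ∀ U : ℝ, 0 ≤ U →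
      ((-1 / 4 - s) * ((-0.0770697412 : ℝ) + (-557 / 256) * n₁) + (s - (-3 / 10)) * ((-0.0967679214 : ℝ) + (-9123 / 4096) * n₁)) /
          (-1 / 4 - (-3 / 10)) ≤ energyDensityTT' 1 s U n₁ :=
  floor_on_cell_of_tPrime_end_rows 1 hn0 hn2 (by norm_num)
    (fun _ hU => fermiSeaTangentRow_tPrime_neg_three_div_ten_at_one_div_four hU hn0 hn2)
    (fun _ hU => fermiSeaTangentRow_tPrime_neg_one_div_four_at_one_div_four hU hn0 hn2)

/-- **Dilute floor on `t′ ∈ [-1/4, -1/5]` from the rows touching at `1/4`** (any density `0 ≤ n₁ < 2`, every `U ≥ 0`; the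
`t′`-chord of the two end rows). [cite: LiebLoss1993, §8, Theorem 8.2] [cite: Ruelle1969, §3.3] -/
theorem lsco_dilute14_floor_right {n₁ : ℝ} (hn0 : 0 ≤ n₁) (hn2 : n₁ < 2) :
    ∀ s ∈ Icc (-1 / 4 : ℝ) (-1 / 5), ∀ U : ℝ, 0 ≤ U →
      ((-1 / 5 - s) * ((-0.0967679214 : ℝ) + (-9123 / 4096) * n₁) + (s - (-1 / 4)) * ((-0.1078809096 : ℝ) + (-2369 / 1024) * n₁)) /
          (-1 / 5 - (-1 / 4)) ≤ energyDensityTT' 1 s U n₁ :=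
  floor_on_cell_of_tPrime_end_rows 1 hn0 hn2 (by norm_num)
    (fun _ hU => fermiSeaTangentRow_tPrime_neg_one_div_four_at_one_div_four hU hn0 hn2)
    (fun _ hU => fermiSeaTangentRow_tPrime_neg_one_div_five_at_one_div_four hU hn0 hn2)

/-- **Dilute floor on `t′ ∈ [-3/10, -1/4]` from the rows touching at `3/10`** (any density `0 ≤ n₁ < 2`, every `U ≥ 0`; the
`t′`-chord of the two end rows). [cite: LiebLoss1993, §8, Theorem 8.2] [cite: Ruelle1969, §3.3] -/
theorem lsco_dilute310_floor_left {n₁ : ℝ} (hn0 : 0 ≤ n₁) (hn2 : n₁ < 2) :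
    ∀ s ∈ Icc (-3 / 10 : ℝ) (-1 / 4), ∀ U : ℝ, 0 ≤ U →
      ((-1 / 4 - s) * ((-0.1114760636 : ℝ) + (-4197 / 2048) * n₁) + (s - (-3 / 10)) * ((-0.1394245520 : ℝ) + (-531 / 256) * n₁)) /
          (-1 / 4 - (-3 / 10)) ≤ energyDensityTT' 1 s U n₁ :=
  floor_on_cell_of_tPrime_end_rows 1 hn0 hn2 (by norm_num)
    (fun _ hU => fermiSeaTangentRow_tPrime_neg_three_div_ten_at_three_div_ten hU hn0 hn2)
    (fun _ hU => fermiSeaTangentRow_tPrime_neg_one_div_four_at_three_div_ten hU hn0 hn2)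

/-- **Dilute floor on `t′ ∈ [-1/4, -1/5]` from the rows touching at `3/10`** (any density `0 ≤ n₁ < 2`, every `U ≥ 0`; the
`t′`-chord of the two end rows). [cite: LiebLoss1993, §8, Theorem 8.2] [cite: Ruelle1969, §3.3] -/
theorem lsco_dilute310_floor_right {n₁ : ℝ} (hn0 : 0 ≤ n₁) (hn2 : n₁ < 2) :
    ∀ s ∈ Icc (-1 / 4 : ℝ) (-1 / 5), ∀ U : ℝ, 0 ≤ U →
      ((-1 / 5 - s) * ((-0.1394245520 : ℝ) + (-531 / 256) * n₁) + (s - (-1 / 4)) * ((-0.1561716534 : ℝ) + (-547 / 256) * n₁)) /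
          (-1 / 5 - (-1 / 4)) ≤ energyDensityTT' 1 s U n₁ :=
  floor_on_cell_of_tPrime_end_rows 1 hn0 hn2 (by norm_num)
    (fun _ hU => fermiSeaTangentRow_tPrime_neg_one_div_four_at_three_div_ten hU hn0 hn2)
    (fun _ hU => fermiSeaTangentRow_tPrime_neg_one_div_five_at_three_div_ten hU hn0 hn2)

/-! ## §2 `(≤ 1/5 | ≥ 1)` EXCLUDED on `t′ ∈ [−3/10, −1/5] × U ∈ [36/5, 9]` -/

/-- **Left `t′`-half, columns `[36/5, 8]`, `n₁ = 1/5`** (dilute floor: rows touching at `1/4`). [cite: Israel1979, Thm. I.2.4] [cite: EmeryKivelsonLin1990, pp. 475–476] -/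
theorem lsco78_ps_1o5_left_columns_v2 (hVB : cert_obx32x4tpm1o4D1200_openbox_32x4_N112_planes)
    (hK29 : cert_laBoxE_K2diag_GU29o5n1tpm3o10_j295889_up) (hK8 : cert_laBoxE_K2diag_GU8n1tpm3o10_j299783_up)
    (h21 : cert_r21_luc_tl_upper_n1_U6) (h487 : cert_r487_hubSQ_hanK7R6_U10_r5_e4_so4blk)
    (h427 : cert_r427_hubSQ_hanK7_U5_r5_e4_so4blk) (h488 : cert_r488_hubSQ_hanK7R6_U6_r5_e4_so4blk)
    (h472 : cert_r472_pb2_tl_upper_n1_U8) (h428 : cert_r428_hubSQ_hanK7R6_U8_r5_e4_so4blk)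
    {s : ℝ} (hs : s ∈ Icc (-3 / 10 : ℝ) (-1 / 4)) {U : ℝ} (hU : U ∈ Icc (36 / 5 : ℝ) 8)
    {ω₁ ω₂ : InfVolFermionState 2} (h₁ : ω₁.IsTranslationInvariant) (h₂ : ω₂.IsTranslationInvariant)
    (hρ₁ : 0 < ω₁.density) (hρ₁' : ω₁.density ≤ 1 / 5) (hρ₂ : 1 ≤ ω₂.density) (hρ₂' : ω₂.density < 2)
    {lam : ℝ} (hl0 : 0 < lam) (hl1 : lam < 1) :
    energyDensityTT' 1 s U (mix lam hl0.le hl1.le ω₁ ω₂).density <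
      (mix lam hl0.le hl1.le ω₁ ω₂).meanEnergy (hubbardTTPrimeFermionInteraction 1 s U) 1 := by
  refine ps_not_groundState_mix_on_cell_of_columns 1 (s₁ := -3 / 10) (s₂ := -1 / 4) (U₁ := 36 / 5) (U₂ := 8)
    (n₁ := 1 / 5) (n₂ := 1) (a := 5 / 32) (b := 27 / 32) (by norm_num) (by norm_num) (by norm_num) (by norm_num)
    (by norm_num) (by norm_num) (by norm_num) (by norm_num)
    (lsco78_capPlane_on_cell_of hVB (by norm_num) (by norm_num) (by norm_num))
    (fun s hs => lsco_n1_lawAt_of hK29 hK8 h21 h487 h427 h488 h472 h428 (U₀ := 36 / 5) (by norm_num) s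
      ⟨hs.1.trans' (by norm_num), hs.2.trans (by norm_num)⟩)
    (fun s hs => lsco_n1_law8_of hK8 h472 h428 s ⟨hs.1.trans' (by norm_num), hs.2.trans (by norm_num)⟩)
    (fun s hs U hU => lsco_dilute14_floor_left (n₁ := 1 / 5) (by norm_num) (by norm_num) s hs U (by linarith [hU.1]))
    ?_ ?_ hs hU h₁ h₂ hρ₁ hρ₁' hρ₂ hρ₂' hl0 hl1
  · intro s hs; obtain ⟨h1, h2⟩ := hs; push_cast; norm_num; nlinarith [h1, h2]
  · intro s hs; obtain ⟨h1, h2⟩ := hs; push_cast; norm_num; nlinarith [h1, h2]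

/-- **Left `t′`-half, `U ∈ [8, 9]`, `n₁ = 1/5`.** [cite: Israel1979, Thm. I.2.4] [cite: Griffiths1966, §II] -/
theorem lsco78_ps_1o5_left_above_v2 (hVB : cert_obx32x4tpm1o4D1200_openbox_32x4_N112_planes)
    (hK8 : cert_laBoxE_K2diag_GU8n1tpm3o10_j299783_up)
    (h472 : cert_r472_pb2_tl_upper_n1_U8) (h428 : cert_r428_hubSQ_hanK7R6_U8_r5_e4_so4blk)
    {s : ℝ} (hs : s ∈ Icc (-3 / 10 : ℝ) (-1 / 4)) {U : ℝ} (hU : U ∈ Icc (8 : ℝ) (9))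
    {ω₁ ω₂ : InfVolFermionState 2} (h₁ : ω₁.IsTranslationInvariant) (h₂ : ω₂.IsTranslationInvariant)
    (hρ₁ : 0 < ω₁.density) (hρ₁' : ω₁.density ≤ 1 / 5) (hρ₂ : 1 ≤ ω₂.density) (hρ₂' : ω₂.density < 2)
    {lam : ℝ} (hl0 : 0 < lam) (hl1 : lam < 1) :
    energyDensityTT' 1 s U (mix lam hl0.le hl1.le ω₁ ω₂).density <
      (mix lam hl0.le hl1.le ω₁ ω₂).meanEnergy (hubbardTTPrimeFermionInteraction 1 s U) 1 := by
  refine ps_not_groundState_mix_above_column 1 (s₁ := -3 / 10) (s₂ := -1 / 4) (U₂ := 8) (U₃ := 9)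
    (n₁ := 1 / 5) (n₂ := 1) (a := 5 / 32) (b := 27 / 32) (by norm_num) (by norm_num) (by norm_num) (by norm_num)
    (by norm_num) (by norm_num) (by norm_num) (by norm_num)
    (lsco78_capPlane_on_cell_of hVB (by norm_num) (by norm_num) (by norm_num))
    (fun s hs => lsco_n1_law8_of hK8 h472 h428 s ⟨hs.1.trans' (by norm_num), hs.2.trans (by norm_num)⟩)
    (fun s hs U hU => lsco_dilute14_floor_left (n₁ := 1 / 5) (by norm_num) (by norm_num) s hs U (by linarith [hU.1]))
    ?_ hs hU h₁ h₂ hρ₁ hρ₁' hρ₂ hρ₂' hl0 hl1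
  intro s hs; obtain ⟨h1, h2⟩ := hs; push_cast; norm_num; nlinarith [h1, h2]

/-- **Right `t′`-half, columns `[36/5, 8]`, `n₁ = 1/5`.** [cite: Israel1979, Thm. I.2.4] [cite: EmeryKivelsonLin1990, pp. 475–476] -/
theorem lsco78_ps_1o5_right_columns_v2 (hVB : cert_obx32x4tpm1o4D1200_openbox_32x4_N112_planes)
    (hK29 : cert_laBoxE_K2diag_GU29o5n1tpm3o10_j295889_up) (hK8 : cert_laBoxE_K2diag_GU8n1tpm3o10_j299783_up)
    (h21 : cert_r21_luc_tl_upper_n1_U6) (h487 : cert_r487_hubSQ_hanK7R6_U10_r5_e4_so4blk)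
    (h427 : cert_r427_hubSQ_hanK7_U5_r5_e4_so4blk) (h488 : cert_r488_hubSQ_hanK7R6_U6_r5_e4_so4blk)
    (h472 : cert_r472_pb2_tl_upper_n1_U8) (h428 : cert_r428_hubSQ_hanK7R6_U8_r5_e4_so4blk)
    {s : ℝ} (hs : s ∈ Icc (-1 / 4 : ℝ) (-1 / 5)) {U : ℝ} (hU : U ∈ Icc (36 / 5 : ℝ) 8)
    {ω₁ ω₂ : InfVolFermionState 2} (h₁ : ω₁.IsTranslationInvariant) (h₂ : ω₂.IsTranslationInvariant)
    (hρ₁ : 0 < ω₁.density) (hρ₁' : ω₁.density ≤ 1 / 5) (hρ₂ : 1 ≤ ω₂.density) (hρ₂' : ω₂.density < 2)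
    {lam : ℝ} (hl0 : 0 < lam) (hl1 : lam < 1) :
    energyDensityTT' 1 s U (mix lam hl0.le hl1.le ω₁ ω₂).density <
      (mix lam hl0.le hl1.le ω₁ ω₂).meanEnergy (hubbardTTPrimeFermionInteraction 1 s U) 1 := by
  refine ps_not_groundState_mix_on_cell_of_columns 1 (s₁ := -1 / 4) (s₂ := -1 / 5) (U₁ := 36 / 5) (U₂ := 8)
    (n₁ := 1 / 5) (n₂ := 1) (a := 5 / 32) (b := 27 / 32) (by norm_num) (by norm_num) (by norm_num) (by norm_num)
    (by norm_num) (by norm_num) (by norm_num) (by norm_num)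
    (lsco78_capPlane_on_cell_of hVB (by norm_num) (by norm_num) (by norm_num))
    (fun s hs => lsco_n1_lawAt_of hK29 hK8 h21 h487 h427 h488 h472 h428 (U₀ := 36 / 5) (by norm_num) s
      ⟨hs.1.trans' (by norm_num), hs.2.trans (by norm_num)⟩)
    (fun s hs => lsco_n1_law8_of hK8 h472 h428 s ⟨hs.1.trans' (by norm_num), hs.2.trans (by norm_num)⟩)
    (fun s hs U hU => lsco_dilute14_floor_right (n₁ := 1 / 5) (by norm_num) (by norm_num) s hs U (by linarith [hU.1]))
    ?_ ?_ hs hU h₁ h₂ hρ₁ hρ₁' hρ₂ hρ₂' hl0 hl1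
  · intro s hs; obtain ⟨h1, h2⟩ := hs; push_cast; norm_num; nlinarith [h1, h2]
  · intro s hs; obtain ⟨h1, h2⟩ := hs; push_cast; norm_num; nlinarith [h1, h2]

/-- **Right `t′`-half, `U ∈ [8, 9]`, `n₁ = 1/5`.** [cite: Israel1979, Thm. I.2.4] [cite: Griffiths1966, §II] -/
theorem lsco78_ps_1o5_right_above_v2 (hVB : cert_obx32x4tpm1o4D1200_openbox_32x4_N112_planes)
    (hK8 : cert_laBoxE_K2diag_GU8n1tpm3o10_j299783_up)
    (h472 : cert_r472_pb2_tl_upper_n1_U8) (h428 : cert_r428_hubSQ_hanK7R6_U8_r5_e4_so4blk)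
    {s : ℝ} (hs : s ∈ Icc (-1 / 4 : ℝ) (-1 / 5)) {U : ℝ} (hU : U ∈ Icc (8 : ℝ) (9))
    {ω₁ ω₂ : InfVolFermionState 2} (h₁ : ω₁.IsTranslationInvariant) (h₂ : ω₂.IsTranslationInvariant)
    (hρ₁ : 0 < ω₁.density) (hρ₁' : ω₁.density ≤ 1 / 5) (hρ₂ : 1 ≤ ω₂.density) (hρ₂' : ω₂.density < 2)
    {lam : ℝ} (hl0 : 0 < lam) (hl1 : lam < 1) :
    energyDensityTT' 1 s U (mix lam hl0.le hl1.le ω₁ ω₂).density <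
      (mix lam hl0.le hl1.le ω₁ ω₂).meanEnergy (hubbardTTPrimeFermionInteraction 1 s U) 1 := by
  refine ps_not_groundState_mix_above_column 1 (s₁ := -1 / 4) (s₂ := -1 / 5) (U₂ := 8) (U₃ := 9)
    (n₁ := 1 / 5) (n₂ := 1) (a := 5 / 32) (b := 27 / 32) (by norm_num) (by norm_num) (by norm_num) (by norm_num)
    (by norm_num) (by norm_num) (by norm_num) (by norm_num)
    (lsco78_capPlane_on_cell_of hVB (by norm_num) (by norm_num) (by norm_num))
    (fun s hs => lsco_n1_law8_of hK8 h472 h428 s ⟨hs.1.trans' (by norm_num), hs.2.trans (by norm_num)⟩)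
    (fun s hs U hU => lsco_dilute14_floor_right (n₁ := 1 / 5) (by norm_num) (by norm_num) s hs U (by linarith [hU.1]))
    ?_ hs hU h₁ h₂ hρ₁ hρ₁' hρ₂ hρ₂' hl0 hl1
  intro s hs; obtain ⟨h1, h2⟩ := hs; push_cast; norm_num; nlinarith [h1, h2]

/-- **THE `(≤ 1/5 | ≥ 1)` SENTENCE, v2: cell `t′ ∈ [−3/10, −1/5] × U ∈ [36/5, 9]` (filling `7/8`).** For every `(s, U)` of the cell no mixture of translation-invariant states of the 2D `t–t′` Hubbard model at `(1, s, U)` with densities `0 < ρ(ω₁) ≤ 1/5`, `1 ≤ ρ(ω₂) < 2` is a ground state (supersedes the parent's `U ∈ [38/5, 43/5]`). [cite: Israel1979, Thm. I.2.4] [cite: EmeryKivelsonLin1990, pp. 475–476] -/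
theorem lsco78_not_groundState_mix_le_1o5_ge_one_v2 (hVB : cert_obx32x4tpm1o4D1200_openbox_32x4_N112_planes)
    (hK29 : cert_laBoxE_K2diag_GU29o5n1tpm3o10_j295889_up) (hK8 : cert_laBoxE_K2diag_GU8n1tpm3o10_j299783_up)
    (h21 : cert_r21_luc_tl_upper_n1_U6) (h487 : cert_r487_hubSQ_hanK7R6_U10_r5_e4_so4blk)
    (h427 : cert_r427_hubSQ_hanK7_U5_r5_e4_so4blk) (h488 : cert_r488_hubSQ_hanK7R6_U6_r5_e4_so4blk)
    (h472 : cert_r472_pb2_tl_upper_n1_U8) (h428 : cert_r428_hubSQ_hanK7R6_U8_r5_e4_so4blk)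
    {s : ℝ} (hs : s ∈ Icc (-3 / 10 : ℝ) (-1 / 5)) {U : ℝ} (hU : U ∈ Icc (36 / 5 : ℝ) (9))
    {ω₁ ω₂ : InfVolFermionState 2} (h₁ : ω₁.IsTranslationInvariant) (h₂ : ω₂.IsTranslationInvariant)
    (hρ₁ : 0 < ω₁.density) (hρ₁' : ω₁.density ≤ 1 / 5) (hρ₂ : 1 ≤ ω₂.density) (hρ₂' : ω₂.density < 2)
    {lam : ℝ} (hl0 : 0 < lam) (hl1 : lam < 1) :
    energyDensityTT' 1 s U (mix lam hl0.le hl1.le ω₁ ω₂).density <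
      (mix lam hl0.le hl1.le ω₁ ω₂).meanEnergy (hubbardTTPrimeFermionInteraction 1 s U) 1 := by
  rcases le_total s (-1 / 4) with hsl | hsr
  · rcases le_total U 8 with hUl | hUr
    · exact lsco78_ps_1o5_left_columns_v2 hVB hK29 hK8 h21 h487 h427 h488 h472 h428 ⟨hs.1, hsl⟩ ⟨hU.1, hUl⟩ h₁ h₂ hρ₁ hρ₁' hρ₂ hρ₂' hl0 hl1
    · exact lsco78_ps_1o5_left_above_v2 hVB hK8 h472 h428 ⟨hs.1, hsl⟩ ⟨hUr, hU.2⟩ h₁ h₂ hρ₁ hρ₁' hρ₂ hρ₂' hl0 hl1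
  · rcases le_total U 8 with hUl | hUr
    · exact lsco78_ps_1o5_right_columns_v2 hVB hK29 hK8 h21 h487 h427 h488 h472 h428 ⟨hsr, hs.2⟩ ⟨hU.1, hUl⟩ h₁ h₂ hρ₁ hρ₁' hρ₂ hρ₂' hl0 hl1
    · exact lsco78_ps_1o5_right_above_v2 hVB hK8 h472 h428 ⟨hsr, hs.2⟩ ⟨hUr, hU.2⟩ h₁ h₂ hρ₁ hρ₁' hρ₂ hρ₂' hl0 hl1

/-! ## §3 `(≤ 1/4 | ≥ 1)` EXCLUDED on `t′ ∈ [−3/10, −1/5] × U ∈ [38/5, 43/5]` -/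

/-- **Left `t′`-half, columns `[38/5, 8]`, `n₁ = 1/4`** (dilute floor: rows touching at `1/4`). [cite: Israel1979, Thm. I.2.4] [cite: EmeryKivelsonLin1990, pp. 475–476] -/
theorem lsco78_ps_1o4_left_columns_v2 (hVB : cert_obx32x4tpm1o4D1200_openbox_32x4_N112_planes)
    (hK29 : cert_laBoxE_K2diag_GU29o5n1tpm3o10_j295889_up) (hK8 : cert_laBoxE_K2diag_GU8n1tpm3o10_j299783_up)
    (h21 : cert_r21_luc_tl_upper_n1_U6) (h487 : cert_r487_hubSQ_hanK7R6_U10_r5_e4_so4blk)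
    (h427 : cert_r427_hubSQ_hanK7_U5_r5_e4_so4blk) (h488 : cert_r488_hubSQ_hanK7R6_U6_r5_e4_so4blk)
    (h472 : cert_r472_pb2_tl_upper_n1_U8) (h428 : cert_r428_hubSQ_hanK7R6_U8_r5_e4_so4blk)
    {s : ℝ} (hs : s ∈ Icc (-3 / 10 : ℝ) (-1 / 4)) {U : ℝ} (hU : U ∈ Icc (38 / 5 : ℝ) 8)
    {ω₁ ω₂ : InfVolFermionState 2} (h₁ : ω₁.IsTranslationInvariant) (h₂ : ω₂.IsTranslationInvariant)
    (hρ₁ : 0 < ω₁.density) (hρ₁' : ω₁.density ≤ 1 / 4) (hρ₂ : 1 ≤ ω₂.density) (hρ₂' : ω₂.density < 2)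
    {lam : ℝ} (hl0 : 0 < lam) (hl1 : lam < 1) :
    energyDensityTT' 1 s U (mix lam hl0.le hl1.le ω₁ ω₂).density <
      (mix lam hl0.le hl1.le ω₁ ω₂).meanEnergy (hubbardTTPrimeFermionInteraction 1 s U) 1 := by
  refine ps_not_groundState_mix_on_cell_of_columns 1 (s₁ := -3 / 10) (s₂ := -1 / 4) (U₁ := 38 / 5) (U₂ := 8)
    (n₁ := 1 / 4) (n₂ := 1) (a := 1 / 6) (b := 5 / 6) (by norm_num) (by norm_num) (by norm_num) (by norm_num)
    (by norm_num) (by norm_num) (by norm_num) (by norm_num)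
    (lsco78_capPlane_on_cell_of hVB (by norm_num) (by norm_num) (by norm_num))
    (fun s hs => lsco_n1_lawAt_of hK29 hK8 h21 h487 h427 h488 h472 h428 (U₀ := 38 / 5) (by norm_num) s
      ⟨hs.1.trans' (by norm_num), hs.2.trans (by norm_num)⟩)
    (fun s hs => lsco_n1_law8_of hK8 h472 h428 s ⟨hs.1.trans' (by norm_num), hs.2.trans (by norm_num)⟩)
    (fun s hs U hU => lsco_dilute14_floor_left (n₁ := 1 / 4) (by norm_num) (by norm_num) s hs U (by linarith [hU.1]))
    ?_ ?_ hs hU h₁ h₂ hρ₁ hρ₁' hρ₂ hρ₂' hl0 hl1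
  · intro s hs; obtain ⟨h1, h2⟩ := hs; push_cast; norm_num; nlinarith [h1, h2]
  · intro s hs; obtain ⟨h1, h2⟩ := hs; push_cast; norm_num; nlinarith [h1, h2]

/-- **Left `t′`-half, `U ∈ [8, 43/5]`, `n₁ = 1/4`.** [cite: Israel1979, Thm. I.2.4] [cite: Griffiths1966, §II] -/
theorem lsco78_ps_1o4_left_above_v2 (hVB : cert_obx32x4tpm1o4D1200_openbox_32x4_N112_planes)
    (hK8 : cert_laBoxE_K2diag_GU8n1tpm3o10_j299783_up)
    (h472 : cert_r472_pb2_tl_upper_n1_U8) (h428 : cert_r428_hubSQ_hanK7R6_U8_r5_e4_so4blk)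
    {s : ℝ} (hs : s ∈ Icc (-3 / 10 : ℝ) (-1 / 4)) {U : ℝ} (hU : U ∈ Icc (8 : ℝ) (43 / 5))
    {ω₁ ω₂ : InfVolFermionState 2} (h₁ : ω₁.IsTranslationInvariant) (h₂ : ω₂.IsTranslationInvariant)
    (hρ₁ : 0 < ω₁.density) (hρ₁' : ω₁.density ≤ 1 / 4) (hρ₂ : 1 ≤ ω₂.density) (hρ₂' : ω₂.density < 2)
    {lam : ℝ} (hl0 : 0 < lam) (hl1 : lam < 1) :
    energyDensityTT' 1 s U (mix lam hl0.le hl1.le ω₁ ω₂).density <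
      (mix lam hl0.le hl1.le ω₁ ω₂).meanEnergy (hubbardTTPrimeFermionInteraction 1 s U) 1 := by
  refine ps_not_groundState_mix_above_column 1 (s₁ := -3 / 10) (s₂ := -1 / 4) (U₂ := 8) (U₃ := 43 / 5)
    (n₁ := 1 / 4) (n₂ := 1) (a := 1 / 6) (b := 5 / 6) (by norm_num) (by norm_num) (by norm_num) (by norm_num)
    (by norm_num) (by norm_num) (by norm_num) (by norm_num)
    (lsco78_capPlane_on_cell_of hVB (by norm_num) (by norm_num) (by norm_num))
    (fun s hs => lsco_n1_law8_of hK8 h472 h428 s ⟨hs.1.trans' (by norm_num), hs.2.trans (by norm_num)⟩)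
    (fun s hs U hU => lsco_dilute14_floor_left (n₁ := 1 / 4) (by norm_num) (by norm_num) s hs U (by linarith [hU.1]))
    ?_ hs hU h₁ h₂ hρ₁ hρ₁' hρ₂ hρ₂' hl0 hl1
  intro s hs; obtain ⟨h1, h2⟩ := hs; push_cast; norm_num; nlinarith [h1, h2]

/-- **Right `t′`-half, columns `[38/5, 8]`, `n₁ = 1/4`.** [cite: Israel1979, Thm. I.2.4] [cite: EmeryKivelsonLin1990, pp. 475–476] -/
theorem lsco78_ps_1o4_right_columns_v2 (hVB : cert_obx32x4tpm1o4D1200_openbox_32x4_N112_planes)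
    (hK29 : cert_laBoxE_K2diag_GU29o5n1tpm3o10_j295889_up) (hK8 : cert_laBoxE_K2diag_GU8n1tpm3o10_j299783_up)
    (h21 : cert_r21_luc_tl_upper_n1_U6) (h487 : cert_r487_hubSQ_hanK7R6_U10_r5_e4_so4blk)
    (h427 : cert_r427_hubSQ_hanK7_U5_r5_e4_so4blk) (h488 : cert_r488_hubSQ_hanK7R6_U6_r5_e4_so4blk)
    (h472 : cert_r472_pb2_tl_upper_n1_U8) (h428 : cert_r428_hubSQ_hanK7R6_U8_r5_e4_so4blk)
    {s : ℝ} (hs : s ∈ Icc (-1 / 4 : ℝ) (-1 / 5)) {U : ℝ} (hU : U ∈ Icc (38 / 5 : ℝ) 8)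
    {ω₁ ω₂ : InfVolFermionState 2} (h₁ : ω₁.IsTranslationInvariant) (h₂ : ω₂.IsTranslationInvariant)
    (hρ₁ : 0 < ω₁.density) (hρ₁' : ω₁.density ≤ 1 / 4) (hρ₂ : 1 ≤ ω₂.density) (hρ₂' : ω₂.density < 2)
    {lam : ℝ} (hl0 : 0 < lam) (hl1 : lam < 1) :
    energyDensityTT' 1 s U (mix lam hl0.le hl1.le ω₁ ω₂).density <
      (mix lam hl0.le hl1.le ω₁ ω₂).meanEnergy (hubbardTTPrimeFermionInteraction 1 s U) 1 := by
  refine ps_not_groundState_mix_on_cell_of_columns 1 (s₁ := -1 / 4) (s₂ := -1 / 5) (U₁ := 38 / 5) (U₂ := 8)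
    (n₁ := 1 / 4) (n₂ := 1) (a := 1 / 6) (b := 5 / 6) (by norm_num) (by norm_num) (by norm_num) (by norm_num)
    (by norm_num) (by norm_num) (by norm_num) (by norm_num)
    (lsco78_capPlane_on_cell_of hVB (by norm_num) (by norm_num) (by norm_num))
    (fun s hs => lsco_n1_lawAt_of hK29 hK8 h21 h487 h427 h488 h472 h428 (U₀ := 38 / 5) (by norm_num) s
      ⟨hs.1.trans' (by norm_num), hs.2.trans (by norm_num)⟩)
    (fun s hs => lsco_n1_law8_of hK8 h472 h428 s ⟨hs.1.trans' (by norm_num), hs.2.trans (by norm_num)⟩)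
    (fun s hs U hU => lsco_dilute14_floor_right (n₁ := 1 / 4) (by norm_num) (by norm_num) s hs U (by linarith [hU.1]))
    ?_ ?_ hs hU h₁ h₂ hρ₁ hρ₁' hρ₂ hρ₂' hl0 hl1
  · intro s hs; obtain ⟨h1, h2⟩ := hs; push_cast; norm_num; nlinarith [h1, h2]
  · intro s hs; obtain ⟨h1, h2⟩ := hs; push_cast; norm_num; nlinarith [h1, h2]

/-- **Right `t′`-half, `U ∈ [8, 43/5]`, `n₁ = 1/4`.** [cite: Israel1979, Thm. I.2.4] [cite: Griffiths1966, §II] -/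
theorem lsco78_ps_1o4_right_above_v2 (hVB : cert_obx32x4tpm1o4D1200_openbox_32x4_N112_planes)
    (hK8 : cert_laBoxE_K2diag_GU8n1tpm3o10_j299783_up)
    (h472 : cert_r472_pb2_tl_upper_n1_U8) (h428 : cert_r428_hubSQ_hanK7R6_U8_r5_e4_so4blk)
    {s : ℝ} (hs : s ∈ Icc (-1 / 4 : ℝ) (-1 / 5)) {U : ℝ} (hU : U ∈ Icc (8 : ℝ) (43 / 5))
    {ω₁ ω₂ : InfVolFermionState 2} (h₁ : ω₁.IsTranslationInvariant) (h₂ : ω₂.IsTranslationInvariant)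
    (hρ₁ : 0 < ω₁.density) (hρ₁' : ω₁.density ≤ 1 / 4) (hρ₂ : 1 ≤ ω₂.density) (hρ₂' : ω₂.density < 2)
    {lam : ℝ} (hl0 : 0 < lam) (hl1 : lam < 1) :
    energyDensityTT' 1 s U (mix lam hl0.le hl1.le ω₁ ω₂).density <
      (mix lam hl0.le hl1.le ω₁ ω₂).meanEnergy (hubbardTTPrimeFermionInteraction 1 s U) 1 := by
  refine ps_not_groundState_mix_above_column 1 (s₁ := -1 / 4) (s₂ := -1 / 5) (U₂ := 8) (U₃ := 43 / 5)
    (n₁ := 1 / 4) (n₂ := 1) (a := 1 / 6) (b := 5 / 6) (by norm_num) (by norm_num) (by norm_num) (by norm_num)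
    (by norm_num) (by norm_num) (by norm_num) (by norm_num)
    (lsco78_capPlane_on_cell_of hVB (by norm_num) (by norm_num) (by norm_num))
    (fun s hs => lsco_n1_law8_of hK8 h472 h428 s ⟨hs.1.trans' (by norm_num), hs.2.trans (by norm_num)⟩)
    (fun s hs U hU => lsco_dilute14_floor_right (n₁ := 1 / 4) (by norm_num) (by norm_num) s hs U (by linarith [hU.1]))
    ?_ hs hU h₁ h₂ hρ₁ hρ₁' hρ₂ hρ₂' hl0 hl1
  intro s hs; obtain ⟨h1, h2⟩ := hs; push_cast; norm_num; nlinarith [h1, h2]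

/-- **THE `(≤ 1/4 | ≥ 1)` SENTENCE, v2: cell `t′ ∈ [−3/10, −1/5] × U ∈ [38/5, 43/5]` (filling `7/8`)** — no macroscopic mixture of the half-filled (or denser) phase and a phase of hole doping `≥ 75 %` is a ground state there (supersedes the parent's `U ∈ [31/4, 33/4]`). [cite: Israel1979, Thm. I.2.4] [cite: EmeryKivelsonLin1990, pp. 475–476] -/
theorem lsco78_not_groundState_mix_le_1o4_ge_one_v2 (hVB : cert_obx32x4tpm1o4D1200_openbox_32x4_N112_planes)
    (hK29 : cert_laBoxE_K2diag_GU29o5n1tpm3o10_j295889_up) (hK8 : cert_laBoxE_K2diag_GU8n1tpm3o10_j299783_up)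
    (h21 : cert_r21_luc_tl_upper_n1_U6) (h487 : cert_r487_hubSQ_hanK7R6_U10_r5_e4_so4blk)
    (h427 : cert_r427_hubSQ_hanK7_U5_r5_e4_so4blk) (h488 : cert_r488_hubSQ_hanK7R6_U6_r5_e4_so4blk)
    (h472 : cert_r472_pb2_tl_upper_n1_U8) (h428 : cert_r428_hubSQ_hanK7R6_U8_r5_e4_so4blk)
    {s : ℝ} (hs : s ∈ Icc (-3 / 10 : ℝ) (-1 / 5)) {U : ℝ} (hU : U ∈ Icc (38 / 5 : ℝ) (43 / 5))
    {ω₁ ω₂ : InfVolFermionState 2} (h₁ : ω₁.IsTranslationInvariant) (h₂ : ω₂.IsTranslationInvariant)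
    (hρ₁ : 0 < ω₁.density) (hρ₁' : ω₁.density ≤ 1 / 4) (hρ₂ : 1 ≤ ω₂.density) (hρ₂' : ω₂.density < 2)
    {lam : ℝ} (hl0 : 0 < lam) (hl1 : lam < 1) :
    energyDensityTT' 1 s U (mix lam hl0.le hl1.le ω₁ ω₂).density <
      (mix lam hl0.le hl1.le ω₁ ω₂).meanEnergy (hubbardTTPrimeFermionInteraction 1 s U) 1 := by
  rcases le_total s (-1 / 4) with hsl | hsr
  · rcases le_total U 8 with hUl | hUr
    · exact lsco78_ps_1o4_left_columns_v2 hVB hK29 hK8 h21 h487 h427 h488 h472 h428 ⟨hs.1, hsl⟩ ⟨hU.1, hUl⟩ h₁ h₂ hρ₁ hρ₁' hρ₂ hρ₂' hl0 hl1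
    · exact lsco78_ps_1o4_left_above_v2 hVB hK8 h472 h428 ⟨hs.1, hsl⟩ ⟨hUr, hU.2⟩ h₁ h₂ hρ₁ hρ₁' hρ₂ hρ₂' hl0 hl1
  · rcases le_total U 8 with hUl | hUr
    · exact lsco78_ps_1o4_right_columns_v2 hVB hK29 hK8 h21 h487 h427 h488 h472 h428 ⟨hsr, hs.2⟩ ⟨hU.1, hUl⟩ h₁ h₂ hρ₁ hρ₁' hρ₂ hρ₂' hl0 hl1
    · exact lsco78_ps_1o4_right_above_v2 hVB hK8 h472 h428 ⟨hsr, hs.2⟩ ⟨hUr, hU.2⟩ h₁ h₂ hρ₁ hρ₁' hρ₂ hρ₂' hl0 hl1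

/-! ## §4 `(≤ 3/10 | ≥ 1)` EXCLUDED on `t′ ∈ [−1/4, −1/5] × U ∈ [31/4, 83/10]` and on `t′ ∈ [−3/10, −1/5] × U ∈ [8, 81/10]` -/

/-- **Right `t′`-half, columns `[31/4, 8]`, `n₁ = 3/10`** (margin `≈ 8·10⁻⁴` at `31/4`, exact). [cite: Israel1979, Thm. I.2.4] [cite: EmeryKivelsonLin1990, pp. 475–476] -/
theorem lsco78_ps_3o10_right_columns (hVB : cert_obx32x4tpm1o4D1200_openbox_32x4_N112_planes)
    (hK29 : cert_laBoxE_K2diag_GU29o5n1tpm3o10_j295889_up) (hK8 : cert_laBoxE_K2diag_GU8n1tpm3o10_j299783_up)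
    (h21 : cert_r21_luc_tl_upper_n1_U6) (h487 : cert_r487_hubSQ_hanK7R6_U10_r5_e4_so4blk)
    (h427 : cert_r427_hubSQ_hanK7_U5_r5_e4_so4blk) (h488 : cert_r488_hubSQ_hanK7R6_U6_r5_e4_so4blk)
    (h472 : cert_r472_pb2_tl_upper_n1_U8) (h428 : cert_r428_hubSQ_hanK7R6_U8_r5_e4_so4blk)
    {s : ℝ} (hs : s ∈ Icc (-1 / 4 : ℝ) (-1 / 5)) {U : ℝ} (hU : U ∈ Icc (31 / 4 : ℝ) 8)
    {ω₁ ω₂ : InfVolFermionState 2} (h₁ : ω₁.IsTranslationInvariant) (h₂ : ω₂.IsTranslationInvariant)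
    (hρ₁ : 0 < ω₁.density) (hρ₁' : ω₁.density ≤ 3 / 10) (hρ₂ : 1 ≤ ω₂.density) (hρ₂' : ω₂.density < 2)
    {lam : ℝ} (hl0 : 0 < lam) (hl1 : lam < 1) :
    energyDensityTT' 1 s U (mix lam hl0.le hl1.le ω₁ ω₂).density <
      (mix lam hl0.le hl1.le ω₁ ω₂).meanEnergy (hubbardTTPrimeFermionInteraction 1 s U) 1 := by
  refine ps_not_groundState_mix_on_cell_of_columns 1 (s₁ := -1 / 4) (s₂ := -1 / 5) (U₁ := 31 / 4) (U₂ := 8)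
    (n₁ := 3 / 10) (n₂ := 1) (a := 5 / 28) (b := 23 / 28) (by norm_num) (by norm_num) (by norm_num) (by norm_num)
    (by norm_num) (by norm_num) (by norm_num) (by norm_num)
    (lsco78_capPlane_on_cell_of hVB (by norm_num) (by norm_num) (by norm_num))
    (fun s hs => lsco_n1_lawAt_of hK29 hK8 h21 h487 h427 h488 h472 h428 (U₀ := 31 / 4) (by norm_num) s
      ⟨hs.1.trans' (by norm_num), hs.2.trans (by norm_num)⟩)
    (fun s hs => lsco_n1_law8_of hK8 h472 h428 s ⟨hs.1.trans' (by norm_num), hs.2.trans (by norm_num)⟩)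
    (fun s hs U hU => lsco_dilute310_floor_right (n₁ := 3 / 10) (by norm_num) (by norm_num) s hs U (by linarith [hU.1]))
    ?_ ?_ hs hU h₁ h₂ hρ₁ hρ₁' hρ₂ hρ₂' hl0 hl1
  · intro s hs; obtain ⟨h1, h2⟩ := hs; push_cast; norm_num; nlinarith [h1, h2]
  · intro s hs; obtain ⟨h1, h2⟩ := hs; push_cast; norm_num; nlinarith [h1, h2]

/-- **Right `t′`-half, `U ∈ [8, 83/10]`, `n₁ = 3/10`** (margin `≈ 8·10⁻⁴` at `83/10`, exact). [cite: Israel1979, Thm. I.2.4] [cite: Griffiths1966, §II] -/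
theorem lsco78_ps_3o10_right_above (hVB : cert_obx32x4tpm1o4D1200_openbox_32x4_N112_planes)
    (hK8 : cert_laBoxE_K2diag_GU8n1tpm3o10_j299783_up)
    (h472 : cert_r472_pb2_tl_upper_n1_U8) (h428 : cert_r428_hubSQ_hanK7R6_U8_r5_e4_so4blk)
    {s : ℝ} (hs : s ∈ Icc (-1 / 4 : ℝ) (-1 / 5)) {U : ℝ} (hU : U ∈ Icc (8 : ℝ) (83 / 10))
    {ω₁ ω₂ : InfVolFermionState 2} (h₁ : ω₁.IsTranslationInvariant) (h₂ : ω₂.IsTranslationInvariant)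
    (hρ₁ : 0 < ω₁.density) (hρ₁' : ω₁.density ≤ 3 / 10) (hρ₂ : 1 ≤ ω₂.density) (hρ₂' : ω₂.density < 2)
    {lam : ℝ} (hl0 : 0 < lam) (hl1 : lam < 1) :
    energyDensityTT' 1 s U (mix lam hl0.le hl1.le ω₁ ω₂).density <
      (mix lam hl0.le hl1.le ω₁ ω₂).meanEnergy (hubbardTTPrimeFermionInteraction 1 s U) 1 := by
  refine ps_not_groundState_mix_above_column 1 (s₁ := -1 / 4) (s₂ := -1 / 5) (U₂ := 8) (U₃ := 83 / 10)
    (n₁ := 3 / 10) (n₂ := 1) (a := 5 / 28) (b := 23 / 28) (by norm_num) (by norm_num) (by norm_num) (by norm_num)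
    (by norm_num) (by norm_num) (by norm_num) (by norm_num)
    (lsco78_capPlane_on_cell_of hVB (by norm_num) (by norm_num) (by norm_num))
    (fun s hs => lsco_n1_law8_of hK8 h472 h428 s ⟨hs.1.trans' (by norm_num), hs.2.trans (by norm_num)⟩)
    (fun s hs U hU => lsco_dilute310_floor_right (n₁ := 3 / 10) (by norm_num) (by norm_num) s hs U (by linarith [hU.1]))
    ?_ hs hU h₁ h₂ hρ₁ hρ₁' hρ₂ hρ₂' hl0 hl1
  intro s hs; obtain ⟨h1, h2⟩ := hs; push_cast; norm_num; nlinarith [h1, h2]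

/-- **Left `t′`-half, `U ∈ [8, 81/10]`, `n₁ = 3/10`** (margin `≈ 9·10⁻⁴` at `81/10`, exact; below `U = 8` the left column margin is negative — no column cell). [cite: Israel1979, Thm. I.2.4] [cite: Griffiths1966, §II] -/
theorem lsco78_ps_3o10_left_above (hVB : cert_obx32x4tpm1o4D1200_openbox_32x4_N112_planes)
    (hK8 : cert_laBoxE_K2diag_GU8n1tpm3o10_j299783_up)
    (h472 : cert_r472_pb2_tl_upper_n1_U8) (h428 : cert_r428_hubSQ_hanK7R6_U8_r5_e4_so4blk)
    {s : ℝ} (hs : s ∈ Icc (-3 / 10 : ℝ) (-1 / 4)) {U : ℝ} (hU : U ∈ Icc (8 : ℝ) (81 / 10))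
    {ω₁ ω₂ : InfVolFermionState 2} (h₁ : ω₁.IsTranslationInvariant) (h₂ : ω₂.IsTranslationInvariant)
    (hρ₁ : 0 < ω₁.density) (hρ₁' : ω₁.density ≤ 3 / 10) (hρ₂ : 1 ≤ ω₂.density) (hρ₂' : ω₂.density < 2)
    {lam : ℝ} (hl0 : 0 < lam) (hl1 : lam < 1) :
    energyDensityTT' 1 s U (mix lam hl0.le hl1.le ω₁ ω₂).density <
      (mix lam hl0.le hl1.le ω₁ ω₂).meanEnergy (hubbardTTPrimeFermionInteraction 1 s U) 1 := by
  refine ps_not_groundState_mix_above_column 1 (s₁ := -3 / 10) (s₂ := -1 / 4) (U₂ := 8) (U₃ := 81 / 10)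
    (n₁ := 3 / 10) (n₂ := 1) (a := 5 / 28) (b := 23 / 28) (by norm_num) (by norm_num) (by norm_num) (by norm_num)
    (by norm_num) (by norm_num) (by norm_num) (by norm_num)
    (lsco78_capPlane_on_cell_of hVB (by norm_num) (by norm_num) (by norm_num))
    (fun s hs => lsco_n1_law8_of hK8 h472 h428 s ⟨hs.1.trans' (by norm_num), hs.2.trans (by norm_num)⟩)
    (fun s hs U hU => lsco_dilute310_floor_left (n₁ := 3 / 10) (by norm_num) (by norm_num) s hs U (by linarith [hU.1]))
    ?_ hs hU h₁ h₂ hρ₁ hρ₁' hρ₂ hρ₂' hl0 hl1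
  intro s hs; obtain ⟨h1, h2⟩ := hs; push_cast; norm_num; nlinarith [h1, h2]

/-- **THE `(≤ 3/10 | ≥ 1)` SENTENCE on the right half-cell `t′ ∈ [−1/4, −1/5] × U ∈ [31/4, 83/10]` (filling `7/8`)**: no macroscopic
mixture of the half-filled (or denser) phase and a phase of density `≤ 3/10` (hole doping `≥ 70 %`) is a ground state there.
[cite: Israel1979, Thm. I.2.4] [cite: EmeryKivelsonLin1990, pp. 475–476] -/
theorem lsco78_not_groundState_mix_le_3o10_ge_one_right (hVB : cert_obx32x4tpm1o4D1200_openbox_32x4_N112_planes)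
    (hK29 : cert_laBoxE_K2diag_GU29o5n1tpm3o10_j295889_up) (hK8 : cert_laBoxE_K2diag_GU8n1tpm3o10_j299783_up)
    (h21 : cert_r21_luc_tl_upper_n1_U6) (h487 : cert_r487_hubSQ_hanK7R6_U10_r5_e4_so4blk)
    (h427 : cert_r427_hubSQ_hanK7_U5_r5_e4_so4blk) (h488 : cert_r488_hubSQ_hanK7R6_U6_r5_e4_so4blk)
    (h472 : cert_r472_pb2_tl_upper_n1_U8) (h428 : cert_r428_hubSQ_hanK7R6_U8_r5_e4_so4blk)
    {s : ℝ} (hs : s ∈ Icc (-1 / 4 : ℝ) (-1 / 5)) {U : ℝ} (hU : U ∈ Icc (31 / 4 : ℝ) (83 / 10))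
    {ω₁ ω₂ : InfVolFermionState 2} (h₁ : ω₁.IsTranslationInvariant) (h₂ : ω₂.IsTranslationInvariant)
    (hρ₁ : 0 < ω₁.density) (hρ₁' : ω₁.density ≤ 3 / 10) (hρ₂ : 1 ≤ ω₂.density) (hρ₂' : ω₂.density < 2)
    {lam : ℝ} (hl0 : 0 < lam) (hl1 : lam < 1) :
    energyDensityTT' 1 s U (mix lam hl0.le hl1.le ω₁ ω₂).density <
      (mix lam hl0.le hl1.le ω₁ ω₂).meanEnergy (hubbardTTPrimeFermionInteraction 1 s U) 1 := by
  rcases le_total U 8 with hUl | hUr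
  · exact lsco78_ps_3o10_right_columns hVB hK29 hK8 h21 h487 h427 h488 h472 h428 hs ⟨hU.1, hUl⟩ h₁ h₂ hρ₁ hρ₁' hρ₂ hρ₂' hl0 hl1
  · exact lsco78_ps_3o10_right_above hVB hK8 h472 h428 hs ⟨hUr, hU.2⟩ h₁ h₂ hρ₁ hρ₁' hρ₂ hρ₂' hl0 hl1

/-- **THE `(≤ 3/10 | ≥ 1)` SENTENCE on the full `t′`-range above the `U = 8` column: `t′ ∈ [−3/10, −1/5] × U ∈ [8, 81/10]`.**
[cite: Israel1979, Thm. I.2.4] [cite: Griffiths1966, §II] -/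
theorem lsco78_not_groundState_mix_le_3o10_ge_one (hVB : cert_obx32x4tpm1o4D1200_openbox_32x4_N112_planes)
    (hK8 : cert_laBoxE_K2diag_GU8n1tpm3o10_j299783_up)
    (h472 : cert_r472_pb2_tl_upper_n1_U8) (h428 : cert_r428_hubSQ_hanK7R6_U8_r5_e4_so4blk)
    {s : ℝ} (hs : s ∈ Icc (-3 / 10 : ℝ) (-1 / 5)) {U : ℝ} (hU : U ∈ Icc (8 : ℝ) (81 / 10))
    {ω₁ ω₂ : InfVolFermionState 2} (h₁ : ω₁.IsTranslationInvariant) (h₂ : ω₂.IsTranslationInvariant)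
    (hρ₁ : 0 < ω₁.density) (hρ₁' : ω₁.density ≤ 3 / 10) (hρ₂ : 1 ≤ ω₂.density) (hρ₂' : ω₂.density < 2)
    {lam : ℝ} (hl0 : 0 < lam) (hl1 : lam < 1) :
    energyDensityTT' 1 s U (mix lam hl0.le hl1.le ω₁ ω₂).density <
      (mix lam hl0.le hl1.le ω₁ ω₂).meanEnergy (hubbardTTPrimeFermionInteraction 1 s U) 1 := by
  rcases le_total s (-1 / 4) with hsl | hsr
  · exact lsco78_ps_3o10_left_above hVB hK8 h472 h428 ⟨hs.1, hsl⟩ hU h₁ h₂ hρ₁ hρ₁' hρ₂ hρ₂' hl0 hl1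
  · exact lsco78_ps_3o10_right_above hVB hK8 h472 h428 ⟨hsr, hs.2⟩ ⟨hU.1, hU.2.trans (by norm_num)⟩ h₁ h₂ hρ₁ hρ₁' hρ₂ hρ₂'
      hl0 hl1
end Summit.Ventures.CertifiedManyBodySolver.Downfold
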